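import Mathlib
import Summits.KontsevichZagierPeriods.Zeta5Search.BrickBlockWeightTwo

/-!
# BrickMultiplierLocalityTwo — the descent multipliers of the centre-free brick kernel at the prime `2` as functions of
the block index `K`: `2`-integrality and DIGIT-LOCALITY `v₂(ψ(K′) − ψ(K)) ≥ e + 1` for `2^e ∣ K − K′` of the unit parts
of `λ = c̃_{2K+1,A}(2N+1)/c̃_{K,A}(N) = 2^B·ψ(K)·(−(K+N+1))^B` (odd row) and
`μ = c̃_{2K+1,A}(2N+2)/c̃_{K,A}(N) = 2^A·ĥ(K)·((−(K+N+1))(2N+1−K))^B` (holes of an even row) (cell `pub-zeta5`, seat ct-1 g43)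

HONEST FRAMING: systematic search; no irrationality claim unless certified.  INSTRUMENT lemmas about ratios of the top
Laurent coefficients `cTop A B 0 n j = c̃_{j,A}(n) = ±C(n,j)^A[C(n+j,j)C(2n−j,n)]^B` of the centre-free brick kernels
(`BrickTopCoefficient`); nothing about `ζ(5)`/`ζ(3)`; no `γ`/record statement; records in print UNMOVED; NOTHING IS
DISCHARGED here (net named-fact debt 0).

WHY (ct-1 g42's README §2, the WEIGHT side of the `p = 2` reduction): the one-level reduction at `2`
(`BrickLevelReductionTwo`) turns a weighted cell sum on the row `2N+1` / `2N+2` into weighted sums on the rows `N`, `N+1` with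
the block weight `W(K) = Σ_{k₀} g(k₀+2K)·λ_{k₀}(K)` and the hole weight `G(K) = g(2K+1)·μ(K)`.  For the induction the new
weights must again be DIGIT-LOCAL in `K` (`2^e ∣ K − K′ ⇒ 2^{e+1} ∣ ω(K′) − ω(K)`), which needs the locality of the multipliers
themselves.  By ct-1 g42's factorisations (`BrickResidueLawTwo.cTop_two_odd_odd`, `BrickHoleResidueLawTwo.cTop_two_hat`) the
multipliers are `2^B`, resp. `2^A`, times a polynomial in `K`, times a ratio `ψ(K)`, `ĥ(K)` of products of ODD linear forms
`c − 2K` over FIXED index sets; such a ratio is `2`-integral and satisfies `ψ(K′) ≡ ψ(K) (mod 2^{e+1})` as soon as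
`K′ ≡ K (mod 2^e)` (every factor moves by `2(K − K′)`).  This file records exactly that, packaged as existence statements so
that the explicit products stay inside this file:

* `two_mul_modEq_of_dvd`, `padicValuation_intCast_le_of_dvd`, `padicValuation_div_sub_div_le`, `padicValuation_div_le_one_of_odd`
  — the arithmetic of ratios of odd integers at `2`;
* **`exists_psi_two_odd_odd`** — odd row `2N+1`, odd pole `2K+1`: `∃ ψ`, `λ₁(K) = 2^B·ψ(K)·(−(K+N+1))^B` (`K ≤ N`),
  `v₂(ψ(K)) ≤ 1`, `v₂(ψ(K′) − ψ(K)) ≤ exp(−(e+1))` for `2^e ∣ K − K′` (all `e ≥ 0`, all `K, K′`);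
* **`exists_hat_two`** — even row `2N+2`, odd pole (hole) `2K+1` over the row `N`: `∃ ĥ`,
  `μ(K) = 2^A·ĥ(K)·((−(K+N+1))·((2N+1)−K))^B`, `v₂(ĥ(K)) ≤ 1`, `v₂(ĥ(K′) − ĥ(K)) ≤ exp(−(e+1))` for `2^e ∣ K − K′`;
* `lambda_two_even_eq_brickPhi` — even row `2(N+1)`, even pole `2K`: `λ(K) = Φ_{N+1,2}(−K)` EXACTLY (the two signs
  `(−1)^{(N+1)B}` of `cTop_two_even` and `phiCoeff_zero_eq_sign` cancel), so its unit-ness and locality `e+1` are the tree's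
  `BrickPhiAllPrimes.padicValuation_brickPhi_neg_eq_one'` / `padicValuation_brickPhi_sub_le_succ`.

The even-pole multiplier `λ₀(K) = c̃_{2K,A}(2N+1)/c̃_{K,A}(N)` of an odd row needs no lemma of its own: by the even-`A`
reflection `BrickLambdaDigit.lambda_reflect` it is `λ₁(N−K)`.  Theorems only (0 `def`); tree vocabulary; nothing restated.
-/

namespace Summit.KontsevichZagierPeriods.Zeta5Search.BrickMultiplierLocalityTwo

open Finset Nat Polynomial WithZero
open Summit.KontsevichZagierPeriods.Zeta5Search.BrickTopCoefficient (cTop)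
open Summit.KontsevichZagierPeriods.Zeta5Search.BrickKernelFrobenius (brickPhi)
open Summit.KontsevichZagierPeriods.Zeta5Search.BrickLaurent (expandAt phiCoeff coeff_zero_expandAt)
open Summit.KontsevichZagierPeriods.Zeta5Search.BrickLambda (cTop_zero_ne_zero)
open Summit.KontsevichZagierPeriods.Zeta5Search.BrickPhiAllPrimes (phiCoeff_zero_eq_sign)
open Summit.KontsevichZagierPeriods.Zeta5Search.BrickResidueLawTwo (cTop_two_even cTop_two_odd_odd padicValuation_two_pow)
open Summit.KontsevichZagierPeriods.Zeta5Search.BrickHoleResidueLawTwo (cTop_two_hat)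

noncomputable section

/-! ## Ratios of odd integers at the prime `2` -/

/-- `2^e ∣ K − K′ ⇒ 2K′ ≡ 2K (mod 2^{e+1})`. [folklore] -/
theorem two_mul_modEq_of_dvd {K K' : ℤ} {e : ℕ} (h : (2 : ℤ) ^ e ∣ K - K') : 2 * K' ≡ 2 * K [ZMOD 2 ^ (e + 1)] := by
  rw [Int.modEq_iff_dvd, show 2 * K - 2 * K' = (K - K') * 2 by ring, pow_succ]
  exact mul_dvd_mul h dvd_rfl

/-- `2^m ∣ z ⇒ v₂(z) ≤ exp(−m)` for an integer `z`. [folklore] -/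
theorem padicValuation_intCast_le_of_dvd {z : ℤ} {m : ℕ} (h : (2 : ℤ) ^ m ∣ z) :
    Rat.padicValuation 2 (z : ℚ) ≤ exp (-(m : ℤ)) := by
  obtain ⟨c, rfl⟩ := h
  push_cast
  rw [map_mul, padicValuation_two_pow, Rat.padicValuation_cast]
  calc _ ≤ exp (-(m : ℤ)) * 1 := mul_le_mul' le_rfl (Int.padicValuation_le_one _ _)
    _ = _ := mul_one _

/-- An odd integer is a `2`-adic unit: `v₂(d) = 1`. [folklore] -/
theorem padicValuation_intCast_eq_one_of_odd {d : ℤ} (hd : ¬ (2 : ℤ) ∣ d) : Rat.padicValuation 2 (d : ℚ) = 1 := by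
  rw [Rat.padicValuation_cast, Int.padicValuation_eq_one_iff]
  exact_mod_cast hd

/-- A ratio `n/d` of integers with `d` odd is `2`-integral. [folklore] -/
theorem padicValuation_div_le_one_of_odd (n : ℤ) {d : ℤ} (hd : ¬ (2 : ℤ) ∣ d) :
    Rat.padicValuation 2 ((n : ℚ) / d) ≤ 1 := by
  rw [map_div₀, padicValuation_intCast_eq_one_of_odd hd, div_one, Rat.padicValuation_cast]
  exact Int.padicValuation_le_one 2 n

/-- **Locality of ratios of odd integers**: if `n′ ≡ n`, `d′ ≡ d (mod 2^m)` and `d, d′` are odd, then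
`v₂(n′/d′ − n/d) ≤ exp(−m)` (`n′d − nd′ ≡ nd − nd = 0`). [folklore] -/
theorem padicValuation_div_sub_div_le {n n' d d' : ℤ} {m : ℕ} (hn : n' ≡ n [ZMOD 2 ^ m]) (hd : d' ≡ d [ZMOD 2 ^ m])
    (hdo : ¬ (2 : ℤ) ∣ d) (hdo' : ¬ (2 : ℤ) ∣ d') :
    Rat.padicValuation 2 ((n' : ℚ) / d' - n / d) ≤ exp (-(m : ℤ)) := by
  have hd0 : d ≠ 0 := fun h => hdo (h ▸ dvd_zero 2)
  have hd0' : d' ≠ 0 := fun h => hdo' (h ▸ dvd_zero 2)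
  have hdQ : (d : ℚ) ≠ 0 := by exact_mod_cast hd0
  have hdQ' : (d' : ℚ) ≠ 0 := by exact_mod_cast hd0'
  rw [div_sub_div _ _ hdQ' hdQ, map_div₀, map_mul, padicValuation_intCast_eq_one_of_odd hdo,
    padicValuation_intCast_eq_one_of_odd hdo', mul_one, div_one, ← Int.cast_mul, ← Int.cast_mul, ← Int.cast_sub]
  refine padicValuation_intCast_le_of_dvd ((Int.modEq_iff_dvd.1 ?_))
  calc d' * n ≡ d * n [ZMOD 2 ^ m] := hd.mul_right n
    _ ≡ d * n' [ZMOD 2 ^ m] := hn.symm.mul_left d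
    _ = n' * d := mul_comm _ _

/-- A product of odd integers is odd. [folklore] -/
theorem not_two_dvd_prod {ι : Type*} (s : Finset ι) {f : ι → ℤ} (h : ∀ i ∈ s, ¬ (2 : ℤ) ∣ f i) :
    ¬ (2 : ℤ) ∣ ∏ i ∈ s, f i := by
  rw [Int.prime_two.dvd_finsetProd_iff]
  rintro ⟨i, hi, hdi⟩
  exact h i hi hdi

/-- A power of an odd integer is odd. [folklore] -/
theorem not_two_dvd_pow {d : ℤ} (h : ¬ (2 : ℤ) ∣ d) (A : ℕ) : ¬ (2 : ℤ) ∣ d ^ A :=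
  fun hd => h (Int.prime_two.dvd_of_dvd_pow hd)

/-! ## Odd row `2N+1`, odd pole `2K+1`: `λ₁(K) = 2^B·ψ(K)·(−(K+N+1))^B` -/

/-- The explicit form of the odd-pole multiplier of an odd row: for `2B ≤ A`, `K ≤ N`,
`c̃_{2K+1,A}(2N+1)/c̃_{K,A}(N) = 2^B·ψ_N(K)·(−(K+N+1))^B` with
`ψ_N(K) = D^{A−2B}·[∏_{i=1}^{N}(−2K−2i−1)·∏_{i=0}^{N}(−2K+2N+2i+1)]^B/[∏_{i=0}^{N}(2i−1−2K)]^A`, `D = ∏_{i=0}^{N}(2i+1)`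
(the constant term of ct-1 g42's series identity `BrickResidueLawTwo.cTop_two_odd_odd`). -/
theorem lambda_two_odd_odd_eq {A B : ℕ} (hAB : 2 * B ≤ A) {N K : ℕ} (hK : K ≤ N) :
    cTop A B 0 (2 * N + 1) (2 * K + 1) / cTop A B 0 N K = (2 : ℚ) ^ B *
      ((∏ i ∈ range (N + 1), (2 * (i : ℚ) + 1)) ^ (A - 2 * B) *
        ((∏ i ∈ Icc 1 N, (-(2 * (K : ℚ)) - 2 * i - 1)) * ∏ i ∈ range (N + 1), (-(2 * (K : ℚ)) + 2 * N + 2 * i + 1)) ^ B /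
        (∏ i ∈ range (N + 1), (2 * (i : ℚ) - 1 - 2 * K)) ^ A) * (-((K : ℚ) + N + 1)) ^ B := by
  rw [div_eq_iff (cTop_zero_ne_zero hK A B), cTop_two_odd_odd hAB hK, coeff_zero_expandAt]
  simp only [eval_mul, eval_pow, eval_C, eval_prod, eval_add, eval_sub, eval_X, mul_zero, add_zero, zero_sub]
  ring

/-- **The odd-pole multiplier of an odd row: structure, integrality, locality.**  For `2B ≤ A` and every `N` there is
`ψ : ℕ → ℚ` (the `ψ_N` of `lambda_two_odd_odd_eq`) with
(i) `c̃_{2K+1,A}(2N+1)/c̃_{K,A}(N) = 2^B·ψ(K)·(−(K+N+1))^B` for `K ≤ N`; (ii) `v₂(ψ(K)) ≤ 1` for every `K`;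
(iii) `v₂(ψ(K′) − ψ(K)) ≤ exp(−(e+1))` whenever `2^e ∣ K − K′` (every `e ≥ 0`, every `K, K′`): `ψ` is a ratio of products of
odd linear forms `c − 2K` over index sets depending on `N` only, and each factor moves by `2(K − K′) ≡ 0 (mod 2^{e+1})`. -/
theorem exists_psi_two_odd_odd {A B : ℕ} (hAB : 2 * B ≤ A) (N : ℕ) :
    ∃ ψ : ℕ → ℚ, (∀ K, K ≤ N → cTop A B 0 (2 * N + 1) (2 * K + 1) / cTop A B 0 N K =
        (2 : ℚ) ^ B * ψ K * (-((K : ℚ) + N + 1)) ^ B) ∧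
      (∀ K, Rat.padicValuation 2 (ψ K) ≤ 1) ∧
      (∀ e K K' : ℕ, (2 : ℤ) ^ e ∣ (K : ℤ) - K' → Rat.padicValuation 2 (ψ K' - ψ K) ≤ exp (-((e : ℤ) + 1))) := by
  -- the integer numerator and denominator of `ψ`
  set Z : ℕ → ℤ := fun K => (∏ i ∈ range (N + 1), (2 * (i : ℤ) + 1)) ^ (A - 2 * B) *
    ((∏ i ∈ Icc 1 N, (-(2 * (K : ℤ)) - 2 * i - 1)) * ∏ i ∈ range (N + 1), (-(2 * (K : ℤ)) + 2 * N + 2 * i + 1)) ^ B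
    with hZ
  set D : ℕ → ℤ := fun K => (∏ i ∈ range (N + 1), (2 * (i : ℤ) - 1 - 2 * K)) ^ A with hD
  have hDodd : ∀ K, ¬ (2 : ℤ) ∣ D K := fun K => by
    refine not_two_dvd_pow (not_two_dvd_prod _ fun i _ => ?_) A
    rw [show 2 * (i : ℤ) - 1 - 2 * K = 2 * ((i : ℤ) - K - 1) + 1 by ring]
    exact Int.two_not_dvd_two_mul_add_one _
  refine ⟨fun K => (Z K : ℚ) / (D K : ℚ), fun K hK => ?_, fun K => padicValuation_div_le_one_of_odd _ (hDodd K),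
    fun e K K' hdvd => ?_⟩
  · rw [lambda_two_odd_odd_eq hAB hK, hZ, hD]
    push_cast
    ring
  · have h2 := two_mul_modEq_of_dvd hdvd
    refine padicValuation_div_sub_div_le ?_ ?_ (hDodd K) (hDodd K')
    · simp only [hZ]
      gcongr
    · simp only [hD]
      gcongr

/-! ## Even row `2N+2`, hole `2K+1` over the row `N`: `μ(K) = 2^A·ĥ(K)·((−(K+N+1))·(2N+1−K))^B` -/

/-- The explicit form of the hole multiplier: for `2B ≤ A`, `K ≤ N`,
`c̃_{2K+1,A}(2N+2)/c̃_{K,A}(N) = 2^A·ĥ_N(K)·((−(K+N+1))·((2N+1)−K))^B` with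
`ĥ_N(K) = ((N+1)D)^{A−2B}·[∏_{i=1}^{N+1}(−2K−2i−1)·∏_{i=1}^{N+1}(−2K+2N+2i+1)]^B/[∏_{i=0}^{N+1}(2i−1−2K)]^A`
(the constant term of ct-1 g42's `BrickHoleResidueLawTwo.cTop_two_hat`). -/
theorem mu_two_hat_eq {A B : ℕ} (hAB : 2 * B ≤ A) {N K : ℕ} (hK : K ≤ N) :
    cTop A B 0 (2 * N + 2) (2 * K + 1) / cTop A B 0 N K = (2 : ℚ) ^ A *
      ((((N : ℚ) + 1) * ∏ i ∈ range (N + 1), (2 * (i : ℚ) + 1)) ^ (A - 2 * B) *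
        ((∏ i ∈ Icc 1 (N + 1), (-(2 * (K : ℚ)) - 2 * i - 1)) * ∏ i ∈ Icc 1 (N + 1), (-(2 * (K : ℚ)) + 2 * N + 2 * i + 1)) ^ B /
        (∏ i ∈ range (N + 1 + 1), (2 * (i : ℚ) - 1 - 2 * K)) ^ A) *
      ((-((K : ℚ) + N + 1)) * ((((2 * N + 1 : ℕ) : ℚ) - K))) ^ B := by
  rw [div_eq_iff (cTop_zero_ne_zero hK A B), cTop_two_hat hAB hK, coeff_zero_expandAt]
  simp only [eval_mul, eval_pow, eval_C, eval_prod, eval_add, eval_sub, eval_X, mul_zero, add_zero, zero_sub, zero_add]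
  ring

/-- **The hole multiplier: structure, integrality, locality.**  For `2B ≤ A` and every `N` there is `ĥ : ℕ → ℚ` with
(i) `c̃_{2K+1,A}(2N+2)/c̃_{K,A}(N) = 2^A·ĥ(K)·((−(K+N+1))·((2N+1)−K))^B` for `K ≤ N`; (ii) `v₂(ĥ(K)) ≤ 1`;
(iii) `v₂(ĥ(K′) − ĥ(K)) ≤ exp(−(e+1))` whenever `2^e ∣ K − K′`. -/
theorem exists_hat_two {A B : ℕ} (hAB : 2 * B ≤ A) (N : ℕ) :
    ∃ ĥ : ℕ → ℚ, (∀ K, K ≤ N → cTop A B 0 (2 * N + 2) (2 * K + 1) / cTop A B 0 N K =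
        (2 : ℚ) ^ A * ĥ K * ((-((K : ℚ) + N + 1)) * ((((2 * N + 1 : ℕ) : ℚ) - K))) ^ B) ∧
      (∀ K, Rat.padicValuation 2 (ĥ K) ≤ 1) ∧
      (∀ e K K' : ℕ, (2 : ℤ) ^ e ∣ (K : ℤ) - K' → Rat.padicValuation 2 (ĥ K' - ĥ K) ≤ exp (-((e : ℤ) + 1))) := by
  set Z : ℕ → ℤ := fun K => (((N : ℤ) + 1) * ∏ i ∈ range (N + 1), (2 * (i : ℤ) + 1)) ^ (A - 2 * B) *
    ((∏ i ∈ Icc 1 (N + 1), (-(2 * (K : ℤ)) - 2 * i - 1)) * ∏ i ∈ Icc 1 (N + 1), (-(2 * (K : ℤ)) + 2 * N + 2 * i + 1)) ^ B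
    with hZ
  set D : ℕ → ℤ := fun K => (∏ i ∈ range (N + 1 + 1), (2 * (i : ℤ) - 1 - 2 * K)) ^ A with hD
  have hDodd : ∀ K, ¬ (2 : ℤ) ∣ D K := fun K => by
    refine not_two_dvd_pow (not_two_dvd_prod _ fun i _ => ?_) A
    rw [show 2 * (i : ℤ) - 1 - 2 * K = 2 * ((i : ℤ) - K - 1) + 1 by ring]
    exact Int.two_not_dvd_two_mul_add_one _
  refine ⟨fun K => (Z K : ℚ) / (D K : ℚ), fun K hK => ?_, fun K => padicValuation_div_le_one_of_odd _ (hDodd K),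
    fun e K K' hdvd => ?_⟩
  · rw [mu_two_hat_eq hAB hK, hZ, hD]
    push_cast
    ring
  · have h2 := two_mul_modEq_of_dvd hdvd
    refine padicValuation_div_sub_div_le ?_ ?_ (hDodd K) (hDodd K')
    · simp only [hZ]
      gcongr
    · simp only [hD]
      gcongr

/-! ## Even row `2(N+1)`, even pole `2K`: `λ(K) = Φ_{N+1,2}(−K)` -/

/-- **The even-pole multiplier of an even row is the Frobenius factor**: for `2B ≤ A`, `K ≤ M`,
`c̃_{2K,A}(2M)/c̃_{K,A}(M) = Φ_{M,2}(−K)` (`cTop_two_even`: `= (−1)^{MB}φ_0`, and `φ_0 = (−1)^{MB}Φ_{M,2}(−K)` by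
`BrickPhiAllPrimes.phiCoeff_zero_eq_sign`).  Hence (tree) it is a `2`-adic unit with digit-locality `e+1`. -/
theorem lambda_two_even_eq_brickPhi {A B : ℕ} (hAB : 2 * B ≤ A) {M K : ℕ} (hK : K ≤ M) :
    cTop A B 0 (M * 2) (K * 2) / cTop A B 0 M K = brickPhi A B 2 M (-((K : ℤ) : ℚ)) := by
  rw [div_eq_iff (cTop_zero_ne_zero hK A B), cTop_two_even hAB hK, phiCoeff_zero_eq_sign Nat.prime_two,
    show M * (2 - 1) * B = M * B by norm_num, ← mul_assoc, ← pow_add, ← two_mul, pow_mul, neg_one_sq, one_pow, one_mul]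

end

end Summit.KontsevichZagierPeriods.Zeta5Search.BrickMultiplierLocalityTwo
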